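import Summits.PneNP.PneNP.Theorems.ChebyshevTracialDesignTwoBlockTools
import HarnessLib

/-!
# Cell pnp-psdrank, route `ChebyshevTracialDesign`: TILTED TWO SMALL BLOCKS — the per-level and level-sum expansions (brick 158b;
# crux `TracialDecayExp20`, stmt-PneNP-19878)

Brick 158b (prover g31; MEMO-34 §2). Continuation of brick 158a (`…TwoBlockTools`), the two-block companion of brick 151b. For a
`π`-stable ground set `S`, disjoint blocks `H₁, H₂` whose `S`-vertices lie on pairwise different edges, a bivariate mask `Ψ` and data
`(λ₁, λ₂, κ, L)`:

* §3 `tilted_pointwise_expansion₂` — the twelve-term expansion (main piece `ΨA²`, `A = 2λ₁X₁+2λ₂X₂+L`; pieces `c·ΨA`, `c²Ψ`; per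
  block `Y_iΨA`, `cY_iΨ`, `Y_iΨ`, `Y_i(Y_i−1)Ψ`; the cross piece `Y₁Y₂Ψ`).
* §4 **`avg_tilted_expand₂`** — the shell average `E_{Shell_S(t',c')}[Ψ(X₁,X₂)(2λ₁(X₁−Y₁)+2λ₂(X₂−Y₂)+L−κc)²]` expanded into the twelve
  pieces of 158a §1 with the half-count / half-pair / cross pieces HALF-PINNED (158a §2): three plain averages on `S`, per block two
  one-vertex-pinned averages on `S∖e_v` (factor `c'/|S|`) and one two-vertex-pinned average on `S∖e_v∖e_w`
  (factor `c'(c'−1)/(|S|(|S|−2))`), and the cross average pinned at `v ∈ S∩H₁`, `w ∈ S∩H₂`; `sum_regroup12` (pure algebra).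
* §5 **`levelSum_tilted_expand₂`** — the same summed against a rule `(C, w)` with a polynomial level weight `p` vanishing on the levels
  `c < g` (reduced level `c − g`): twelve polynomially weighted level sums with weights `p`, `pX`, `pX²`, `p(X−g)`, `pX(X−g)`,
  `p(X−g)(X−g−1)` (the same derived weights as brick 151b).
* §6 `mask_bounds`, `pinned_ground_sets` — small tools for the assembly.
WHAT THIS FILE DOES NOT DO: the pricing (brick 158); anything on `TracialDecayExp20` itself, psd rank of P_PM(K_n), or P vs NP.
[cite: Rothvoss2017, §2 (PDF p. 6)]
Stature: support/instrument (kernel lane, no defs, axioms standard). Supports stmt-PneNP-19878.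
-/

set_option linter.dupNamespace false -- `Summit.PneNP.PneNP.…`: summit = sub-problem (D-0017)

noncomputable section

namespace Summit.PneNP.PneNP.Theorems.ChebyshevTracialDesignTwoBlockExpansion

open Finset Polynomial Literature.Barriers.PneNP Literature.Combinatorics.Optimization
open Literature.Combinatorics.Optimization.ShellStep
open Summit.PneNP.PneNP.Theorems.ChebyshevTracialDesignTwoBlockTools
open Summit.PneNP.PneNP.Theorems.ChebyshevTracialDesignTiltedSmallBlockTools
  (reps_vAA_card_eq_zero_of_subset reps_vB_card_le_of_subset)

variable {n : ℕ}

/-! ### §3 The twelve-term expansion of the two-block crossing-plane form -/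

/-- **The tilted two-block form, expanded**: with `A = 2λ₁X₁ + 2λ₂X₂ + L`, `Φ₁ = Ψ·A`, `Φ₀ = Ψ·A²`,
`Ψ·(2λ₁(X₁−Y₁) + 2λ₂(X₂−Y₂) + L − κc)² = Φ₀ − 2κc·Φ₁ + κ²c²·Ψ + Σ_i [−4λ_i·Y_iΦ₁ + 4λ_iκc·Y_iΨ + 4λ_i²·Y_iΨ + 4λ_i²·Y_i(Y_i−1)Ψ]`
`+ 8λ₁λ₂·Y₁Y₂Ψ`. [cite: Rothvoss2017, §2 (PDF p. 6)] -/
theorem tilted_pointwise_expansion₂ (ψv X₁ X₂ Y₁ Y₂ c L l₁ l₂ kap : ℝ) :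
    ψv * (2 * l₁ * (X₁ - Y₁) + 2 * l₂ * (X₂ - Y₂) + L - kap * c) ^ 2 =
      ψv * (2 * l₁ * X₁ + 2 * l₂ * X₂ + L) ^ 2 - 2 * kap * c * (ψv * (2 * l₁ * X₁ + 2 * l₂ * X₂ + L))
        + kap ^ 2 * c ^ 2 * ψv
        - 4 * l₁ * (Y₁ * (ψv * (2 * l₁ * X₁ + 2 * l₂ * X₂ + L))) + 4 * l₁ * kap * c * (Y₁ * ψv)
        + 4 * l₁ ^ 2 * (Y₁ * ψv) + 4 * l₁ ^ 2 * (Y₁ * (Y₁ - 1) * ψv)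
        - 4 * l₂ * (Y₂ * (ψv * (2 * l₁ * X₁ + 2 * l₂ * X₂ + L))) + 4 * l₂ * kap * c * (Y₂ * ψv)
        + 4 * l₂ ^ 2 * (Y₂ * ψv) + 4 * l₂ ^ 2 * (Y₂ * (Y₂ - 1) * ψv)
        + 8 * l₁ * l₂ * (Y₁ * Y₂ * ψv) := by
  ring

/-! ### §4 The per-level expansion of the tilted two-block average -/

/-- Regrouping a level sum of twelve pieces (pure algebra). [cite: Rothvoss2017, §2 (PDF p. 6)] -/
theorem sum_regroup12 {ι κ : Type*} (C : Finset ι) (V₁ V₂ : Finset κ) (W₁ W₂ : κ → Finset κ) (A B D : ι → ℝ)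
    (E₁ F₁ G₁ E₂ F₂ G₂ : κ → ι → ℝ) (J₁ J₂ J₃ : κ → κ → ι → ℝ) (k₁ k₂ k₃ k₄ k₅ k₆ k₇ k₈ k₉ k₁₀ k₁₁ : ℝ) :
    ∑ c ∈ C, (A c - k₁ * B c + k₂ * D c
        - k₃ * ∑ v ∈ V₁, E₁ v c + k₄ * ∑ v ∈ V₁, F₁ v c + k₅ * ∑ v ∈ V₁, G₁ v c + k₆ * ∑ v ∈ V₁, ∑ w ∈ W₁ v, J₁ v w c
        - k₇ * ∑ v ∈ V₂, E₂ v c + k₈ * ∑ v ∈ V₂, F₂ v c + k₉ * ∑ v ∈ V₂, G₂ v c + k₁₀ * ∑ v ∈ V₂, ∑ w ∈ W₂ v, J₂ v w c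
        + k₁₁ * ∑ v ∈ V₁, ∑ w ∈ V₂, J₃ v w c) =
      ∑ c ∈ C, A c - k₁ * ∑ c ∈ C, B c + k₂ * ∑ c ∈ C, D c
        - k₃ * ∑ v ∈ V₁, ∑ c ∈ C, E₁ v c + k₄ * ∑ v ∈ V₁, ∑ c ∈ C, F₁ v c + k₅ * ∑ v ∈ V₁, ∑ c ∈ C, G₁ v c
        + k₆ * ∑ v ∈ V₁, ∑ w ∈ W₁ v, ∑ c ∈ C, J₁ v w c
        - k₇ * ∑ v ∈ V₂, ∑ c ∈ C, E₂ v c + k₈ * ∑ v ∈ V₂, ∑ c ∈ C, F₂ v c + k₉ * ∑ v ∈ V₂, ∑ c ∈ C, G₂ v c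
        + k₁₀ * ∑ v ∈ V₂, ∑ w ∈ W₂ v, ∑ c ∈ C, J₂ v w c
        + k₁₁ * ∑ v ∈ V₁, ∑ w ∈ V₂, ∑ c ∈ C, J₃ v w c := by
  have h3 : ∑ c ∈ C, ∑ v ∈ V₁, E₁ v c = ∑ v ∈ V₁, ∑ c ∈ C, E₁ v c := Finset.sum_comm
  have h4 : ∑ c ∈ C, ∑ v ∈ V₁, F₁ v c = ∑ v ∈ V₁, ∑ c ∈ C, F₁ v c := Finset.sum_comm
  have h5 : ∑ c ∈ C, ∑ v ∈ V₁, G₁ v c = ∑ v ∈ V₁, ∑ c ∈ C, G₁ v c := Finset.sum_comm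
  have h6 : ∑ c ∈ C, ∑ v ∈ V₁, ∑ w ∈ W₁ v, J₁ v w c = ∑ v ∈ V₁, ∑ w ∈ W₁ v, ∑ c ∈ C, J₁ v w c := by
    rw [Finset.sum_comm]; exact sum_congr rfl fun v _ => Finset.sum_comm
  have h7 : ∑ c ∈ C, ∑ v ∈ V₂, E₂ v c = ∑ v ∈ V₂, ∑ c ∈ C, E₂ v c := Finset.sum_comm
  have h8 : ∑ c ∈ C, ∑ v ∈ V₂, F₂ v c = ∑ v ∈ V₂, ∑ c ∈ C, F₂ v c := Finset.sum_comm
  have h9 : ∑ c ∈ C, ∑ v ∈ V₂, G₂ v c = ∑ v ∈ V₂, ∑ c ∈ C, G₂ v c := Finset.sum_comm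
  have h10 : ∑ c ∈ C, ∑ v ∈ V₂, ∑ w ∈ W₂ v, J₂ v w c = ∑ v ∈ V₂, ∑ w ∈ W₂ v, ∑ c ∈ C, J₂ v w c := by
    rw [Finset.sum_comm]; exact sum_congr rfl fun v _ => Finset.sum_comm
  have h11 : ∑ c ∈ C, ∑ v ∈ V₁, ∑ w ∈ V₂, J₃ v w c = ∑ v ∈ V₁, ∑ w ∈ V₂, ∑ c ∈ C, J₃ v w c := by
    rw [Finset.sum_comm]; exact sum_congr rfl fun v _ => Finset.sum_comm
  simp only [sum_add_distrib, sum_sub_distrib, ← mul_sum, h3, h4, h5, h6, h7, h8, h9, h10, h11]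

section Expand

variable {π : Fin n → Fin n} (hπ : ∀ v, π (π v) = v) (hπ' : ∀ v, π v ≠ v)
include hπ hπ'

/-- **The tilted two-block shell average, expanded and half-pinned** (every level `c'`; the shell nonempty when `c' ≥ 1`;
`t' ≥ 2`; `H₁, H₂` disjoint with their `S`-vertices on pairwise different edges). With `A = 2λ₁X₁+2λ₂X₂+L`, `Φ₁ = ΨA`, `Φ₀ = ΨA²`:
`E_{Shell_S(t',c')}[Ψ(X₁,X₂)(2λ₁(X₁−Y₁)+2λ₂(X₂−Y₂)+L−κ·c)²] = E[Φ₀] − 2κc·E[Φ₁] + κ²c²·E[Ψ]`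
`+ Σ_{i=1,2} [−4λ_i(c'/|S|)Σ_{v∈H_i} E_v[Φ₁(·+e_i)] + (4λ_iκc+4λ_i²)(c'/|S|)Σ_{v∈H_i} E_v[Ψ(·+e_i)] + 4λ_i²(c'(c'−1)/(|S|(|S|−2)))Σ_{v,w∈H_i}E_{vw}[Ψ(·+2e_i)]]`
`+ 8λ₁λ₂(c'(c'−1)/(|S|(|S|−2)))Σ_{v∈H₁,w∈H₂}E_{vw}[Ψ(·+e₁+e₂)]`. [cite: Rothvoss2017, §2 (PDF p. 6)] -/
theorem avg_tilted_expand₂ {S : Finset (Fin n)} (hS : ∀ u ∈ S, π u ∈ S) {H₁ H₂ : Finset (Fin n)} (hdisj : Disjoint H₁ H₂)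
    (hsep : ∀ v ∈ S ∩ H₁, ∀ w ∈ S ∩ H₂, w ≠ v ∧ w ≠ π v) {t' : ℕ} (ht' : 2 ≤ t')
    (c' : ℕ) (hne : 1 ≤ c' → (shellIn π S t' c').Nonempty) (Ψ : ℤ → ℤ → ℝ) (l₁ l₂ kap L cR : ℝ) :
    (∑ U ∈ shellIn π S t' c', Ψ ((U ∩ H₁).card : ℤ) ((U ∩ H₂).card : ℤ) *
        (2 * l₁ * (((U ∩ H₁).card : ℝ) - ((half π U ∩ H₁).card : ℝ)) +
          2 * l₂ * (((U ∩ H₂).card : ℝ) - ((half π U ∩ H₂).card : ℝ)) + L - kap * cR) ^ 2) /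
        ((shellIn π S t' c').card : ℝ) =
      (∑ U ∈ shellIn π S t' c', (fun x₁ x₂ : ℤ => Ψ x₁ x₂ * (2 * l₁ * (x₁ : ℝ) + 2 * l₂ * (x₂ : ℝ) + L) ^ 2)
          ((U ∩ H₁).card : ℤ) ((U ∩ H₂).card : ℤ)) / ((shellIn π S t' c').card : ℝ)
      - 2 * kap * cR * ((∑ U ∈ shellIn π S t' c', (fun x₁ x₂ : ℤ => Ψ x₁ x₂ * (2 * l₁ * (x₁ : ℝ) + 2 * l₂ * (x₂ : ℝ) + L))
          ((U ∩ H₁).card : ℤ) ((U ∩ H₂).card : ℤ)) / ((shellIn π S t' c').card : ℝ))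
      + kap ^ 2 * cR ^ 2 * ((∑ U ∈ shellIn π S t' c', Ψ ((U ∩ H₁).card : ℤ) ((U ∩ H₂).card : ℤ)) /
          ((shellIn π S t' c').card : ℝ))
      - 4 * l₁ * (((c' : ℝ) / (S.card : ℝ)) * ∑ v ∈ S ∩ H₁,
          (∑ W ∈ shellIn π (S \ {v, π v}) (t' - 1) (c' - 1),
              (fun x₁ x₂ : ℤ => Ψ (x₁ + 1) x₂ * (2 * l₁ * ((x₁ + 1 : ℤ) : ℝ) + 2 * l₂ * (x₂ : ℝ) + L))
                ((W ∩ H₁).card : ℤ) ((W ∩ H₂).card : ℤ)) /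
            ((shellIn π (S \ {v, π v}) (t' - 1) (c' - 1)).card : ℝ))
      + (4 * l₁ * kap * cR + 4 * l₁ ^ 2) * (((c' : ℝ) / (S.card : ℝ)) * ∑ v ∈ S ∩ H₁,
          (∑ W ∈ shellIn π (S \ {v, π v}) (t' - 1) (c' - 1), (fun x₁ x₂ : ℤ => Ψ (x₁ + 1) x₂) ((W ∩ H₁).card : ℤ) ((W ∩ H₂).card : ℤ)) /
            ((shellIn π (S \ {v, π v}) (t' - 1) (c' - 1)).card : ℝ))
      + 4 * l₁ ^ 2 * ((((c' : ℝ) * ((c' : ℝ) - 1)) / ((S.card : ℝ) * ((S.card : ℝ) - 2))) *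
          ∑ v ∈ S ∩ H₁, ∑ w ∈ (S ∩ H₁) \ {v, π v},
            (∑ W ∈ shellIn π (del2 π S v w) (t' - 2) (c' - 2), (fun x₁ x₂ : ℤ => Ψ (x₁ + 2) x₂) ((W ∩ H₁).card : ℤ) ((W ∩ H₂).card : ℤ)) /
              ((shellIn π (del2 π S v w) (t' - 2) (c' - 2)).card : ℝ))
      - 4 * l₂ * (((c' : ℝ) / (S.card : ℝ)) * ∑ v ∈ S ∩ H₂,
          (∑ W ∈ shellIn π (S \ {v, π v}) (t' - 1) (c' - 1),
              (fun x₁ x₂ : ℤ => Ψ x₁ (x₂ + 1) * (2 * l₁ * (x₁ : ℝ) + 2 * l₂ * ((x₂ + 1 : ℤ) : ℝ) + L))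
                ((W ∩ H₁).card : ℤ) ((W ∩ H₂).card : ℤ)) /
            ((shellIn π (S \ {v, π v}) (t' - 1) (c' - 1)).card : ℝ))
      + (4 * l₂ * kap * cR + 4 * l₂ ^ 2) * (((c' : ℝ) / (S.card : ℝ)) * ∑ v ∈ S ∩ H₂,
          (∑ W ∈ shellIn π (S \ {v, π v}) (t' - 1) (c' - 1), (fun x₁ x₂ : ℤ => Ψ x₁ (x₂ + 1)) ((W ∩ H₁).card : ℤ) ((W ∩ H₂).card : ℤ)) /
            ((shellIn π (S \ {v, π v}) (t' - 1) (c' - 1)).card : ℝ))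
      + 4 * l₂ ^ 2 * ((((c' : ℝ) * ((c' : ℝ) - 1)) / ((S.card : ℝ) * ((S.card : ℝ) - 2))) *
          ∑ v ∈ S ∩ H₂, ∑ w ∈ (S ∩ H₂) \ {v, π v},
            (∑ W ∈ shellIn π (del2 π S v w) (t' - 2) (c' - 2), (fun x₁ x₂ : ℤ => Ψ x₁ (x₂ + 2)) ((W ∩ H₁).card : ℤ) ((W ∩ H₂).card : ℤ)) /
              ((shellIn π (del2 π S v w) (t' - 2) (c' - 2)).card : ℝ))
      + 8 * l₁ * l₂ * ((((c' : ℝ) * ((c' : ℝ) - 1)) / ((S.card : ℝ) * ((S.card : ℝ) - 2))) *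
          ∑ v ∈ S ∩ H₁, ∑ w ∈ S ∩ H₂,
            (∑ W ∈ shellIn π (del2 π S v w) (t' - 2) (c' - 2),
                (fun x₁ x₂ : ℤ => Ψ (x₁ + 1) (x₂ + 1)) ((W ∩ H₁).card : ℤ) ((W ∩ H₂).card : ℤ)) /
              ((shellIn π (del2 π S v w) (t' - 2) (c' - 2)).card : ℝ)) := by
  have hsep' : ∀ v ∈ S ∩ H₂, ∀ w ∈ S ∩ H₁, w ≠ v ∧ w ≠ π v := by
    intro v hv w hw
    obtain ⟨h1, h2⟩ := hsep w hw v hv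
    refine ⟨fun e => h1 e.symm, fun e => h2 ?_⟩
    rw [e, hπ]
  -- the seven half-weighted averages, half-pinned
  have h1 := avg_halfCount_fst_eq hπ hπ' hS hdisj (by omega : 1 ≤ t') c'
    (fun x₁ x₂ : ℤ => Ψ x₁ x₂ * (2 * l₁ * (x₁ : ℝ) + 2 * l₂ * (x₂ : ℝ) + L)) hne
  have h2 := avg_halfCount_fst_eq hπ hπ' hS hdisj (by omega : 1 ≤ t') c' Ψ hne
  have h3 := avg_halfPairs_fst_eq hπ hπ' hS hdisj ht' c' Ψ (fun h => hne (by omega))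
  have h4 := avg_halfCount_fst_eq hπ hπ' hS hdisj.symm (by omega : 1 ≤ t') c'
    (fun x₂ x₁ : ℤ => Ψ x₁ x₂ * (2 * l₁ * (x₁ : ℝ) + 2 * l₂ * (x₂ : ℝ) + L)) hne
  have h5 := avg_halfCount_fst_eq hπ hπ' hS hdisj.symm (by omega : 1 ≤ t') c' (fun x₂ x₁ : ℤ => Ψ x₁ x₂) hne
  have h6 := avg_halfPairs_fst_eq hπ hπ' hS hdisj.symm ht' c' (fun x₂ x₁ : ℤ => Ψ x₁ x₂) (fun h => hne (by omega))
  have h7 := avg_halfCross_eq hπ hπ' hS hdisj hsep ht' c' Ψ (fun h => hne (by omega))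
  simp only [Int.cast_add, Int.cast_one, Int.cast_natCast] at h1 h2 h3 h4 h5 h6 h7 ⊢
  rw [← h1, ← h2, ← h3, ← h4, ← h5, ← h6, ← h7]
  set K : ℝ := ((shellIn π S t' c').card : ℝ)
  simp only [div_eq_mul_inv]
  rw [show ∀ a b c d e f d' e' f' x : ℝ, a * K⁻¹ - 2 * kap * cR * (b * K⁻¹) + kap ^ 2 * cR ^ 2 * (c * K⁻¹)
      - 4 * l₁ * (d * K⁻¹) + (4 * l₁ * kap * cR + 4 * l₁ ^ 2) * (e * K⁻¹) + 4 * l₁ ^ 2 * (f * K⁻¹)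
      - 4 * l₂ * (d' * K⁻¹) + (4 * l₂ * kap * cR + 4 * l₂ ^ 2) * (e' * K⁻¹) + 4 * l₂ ^ 2 * (f' * K⁻¹)
      + 8 * l₁ * l₂ * (x * K⁻¹) =
      (a - 2 * kap * cR * b + kap ^ 2 * cR ^ 2 * c - 4 * l₁ * d + (4 * l₁ * kap * cR + 4 * l₁ ^ 2) * e
        + 4 * l₁ ^ 2 * f - 4 * l₂ * d' + (4 * l₂ * kap * cR + 4 * l₂ ^ 2) * e' + 4 * l₂ ^ 2 * f'
        + 8 * l₁ * l₂ * x) * K⁻¹ from fun a b c d e f d' e' f' x => by ring]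
  congr 1
  simp only [mul_sum, ← sum_add_distrib, ← sum_sub_distrib]
  refine sum_congr rfl fun U _ => ?_
  ring

end Expand

/-! ### §5 The weighted level sum, expanded -/

section LevelSum

variable {π : Fin n → Fin n} (hπ : ∀ v, π (π v) = v) (hπ' : ∀ v, π v ≠ v)
include hπ hπ'

/-- **The weighted level sum of the tilted two-block profile, expanded into twelve polynomially weighted pieces** (any rule
`(C, w)`, a weight `p` vanishing on the levels `c < g`, nonempty shells at the levels `c ≥ g+1`): weights `p`, `pX`, `pX²` for the
plain pieces, `p(X−g)`, `pX(X−g)`, `p(X−g)`, `p(X−g)(X−g−1)` for the pinned pieces of each block, `p(X−g)(X−g−1)` for the cross piece.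
[cite: Rothvoss2017, §2 (PDF p. 6)] -/
theorem levelSum_tilted_expand₂ {S : Finset (Fin n)} (hS : ∀ u ∈ S, π u ∈ S) {H₁ H₂ : Finset (Fin n)} (hdisj : Disjoint H₁ H₂)
    (hsep : ∀ v ∈ S ∩ H₁, ∀ w ∈ S ∩ H₂, w ≠ v ∧ w ≠ π v) {t' : ℕ} (ht' : 2 ≤ t') (g : ℕ) (C : Finset ℕ)
    (w : ℕ → ℝ) (p : ℝ[X]) (hpC : ∀ c ∈ C, c < g → p.eval (c : ℝ) = 0)
    (hne : ∀ c ∈ C, g + 1 ≤ c → (shellIn π S t' (c - g)).Nonempty) (Ψ : ℤ → ℤ → ℝ) (l₁ l₂ kap L : ℝ) :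
    ∑ c ∈ C, w c * (p.eval (c : ℝ) *
        ((∑ U ∈ shellIn π S t' (c - g), Ψ ((U ∩ H₁).card : ℤ) ((U ∩ H₂).card : ℤ) *
            (2 * l₁ * (((U ∩ H₁).card : ℝ) - ((half π U ∩ H₁).card : ℝ)) +
              2 * l₂ * (((U ∩ H₂).card : ℝ) - ((half π U ∩ H₂).card : ℝ)) + L - kap * c) ^ 2) /
          ((shellIn π S t' (c - g)).card : ℝ))) =
      ∑ c ∈ C, w c * (p.eval (c : ℝ) *
          ((∑ U ∈ shellIn π S t' (c - g), (fun x₁ x₂ : ℤ => Ψ x₁ x₂ * (2 * l₁ * (x₁ : ℝ) + 2 * l₂ * (x₂ : ℝ) + L) ^ 2)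
              ((U ∩ H₁).card : ℤ) ((U ∩ H₂).card : ℤ)) / ((shellIn π S t' (c - g)).card : ℝ)))
      - 2 * kap * ∑ c ∈ C, w c * ((p * X).eval (c : ℝ) *
          ((∑ U ∈ shellIn π S t' (c - g), (fun x₁ x₂ : ℤ => Ψ x₁ x₂ * (2 * l₁ * (x₁ : ℝ) + 2 * l₂ * (x₂ : ℝ) + L))
              ((U ∩ H₁).card : ℤ) ((U ∩ H₂).card : ℤ)) / ((shellIn π S t' (c - g)).card : ℝ)))
      + kap ^ 2 * ∑ c ∈ C, w c * ((p * X ^ 2).eval (c : ℝ) *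
          ((∑ U ∈ shellIn π S t' (c - g), Ψ ((U ∩ H₁).card : ℤ) ((U ∩ H₂).card : ℤ)) /
            ((shellIn π S t' (c - g)).card : ℝ)))
      - 4 * l₁ / (S.card : ℝ) * ∑ v ∈ S ∩ H₁, ∑ c ∈ C, w c * ((p * (X - Polynomial.C (g : ℝ))).eval (c : ℝ) *
          ((∑ W ∈ shellIn π (S \ {v, π v}) (t' - 1) (c - g - 1),
              (fun x₁ x₂ : ℤ => Ψ (x₁ + 1) x₂ * (2 * l₁ * ((x₁ + 1 : ℤ) : ℝ) + 2 * l₂ * (x₂ : ℝ) + L))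
                ((W ∩ H₁).card : ℤ) ((W ∩ H₂).card : ℤ)) /
            ((shellIn π (S \ {v, π v}) (t' - 1) (c - g - 1)).card : ℝ)))
      + 4 * l₁ * kap / (S.card : ℝ) * ∑ v ∈ S ∩ H₁, ∑ c ∈ C,
          w c * ((p * X * (X - Polynomial.C (g : ℝ))).eval (c : ℝ) *
          ((∑ W ∈ shellIn π (S \ {v, π v}) (t' - 1) (c - g - 1), (fun x₁ x₂ : ℤ => Ψ (x₁ + 1) x₂) ((W ∩ H₁).card : ℤ) ((W ∩ H₂).card : ℤ)) /
            ((shellIn π (S \ {v, π v}) (t' - 1) (c - g - 1)).card : ℝ)))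
      + 4 * l₁ ^ 2 / (S.card : ℝ) * ∑ v ∈ S ∩ H₁, ∑ c ∈ C,
          w c * ((p * (X - Polynomial.C (g : ℝ))).eval (c : ℝ) *
          ((∑ W ∈ shellIn π (S \ {v, π v}) (t' - 1) (c - g - 1), (fun x₁ x₂ : ℤ => Ψ (x₁ + 1) x₂) ((W ∩ H₁).card : ℤ) ((W ∩ H₂).card : ℤ)) /
            ((shellIn π (S \ {v, π v}) (t' - 1) (c - g - 1)).card : ℝ)))
      + 4 * l₁ ^ 2 / ((S.card : ℝ) * ((S.card : ℝ) - 2)) * ∑ v ∈ S ∩ H₁, ∑ w' ∈ (S ∩ H₁) \ {v, π v}, ∑ c ∈ C,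
          w c * ((p * (X - Polynomial.C (g : ℝ)) * (X - Polynomial.C ((g : ℝ) + 1))).eval (c : ℝ) *
          ((∑ W ∈ shellIn π (del2 π S v w') (t' - 2) (c - g - 2), (fun x₁ x₂ : ℤ => Ψ (x₁ + 2) x₂) ((W ∩ H₁).card : ℤ) ((W ∩ H₂).card : ℤ)) /
            ((shellIn π (del2 π S v w') (t' - 2) (c - g - 2)).card : ℝ)))
      - 4 * l₂ / (S.card : ℝ) * ∑ v ∈ S ∩ H₂, ∑ c ∈ C, w c * ((p * (X - Polynomial.C (g : ℝ))).eval (c : ℝ) *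
          ((∑ W ∈ shellIn π (S \ {v, π v}) (t' - 1) (c - g - 1),
              (fun x₁ x₂ : ℤ => Ψ x₁ (x₂ + 1) * (2 * l₁ * (x₁ : ℝ) + 2 * l₂ * ((x₂ + 1 : ℤ) : ℝ) + L))
                ((W ∩ H₁).card : ℤ) ((W ∩ H₂).card : ℤ)) /
            ((shellIn π (S \ {v, π v}) (t' - 1) (c - g - 1)).card : ℝ)))
      + 4 * l₂ * kap / (S.card : ℝ) * ∑ v ∈ S ∩ H₂, ∑ c ∈ C,
          w c * ((p * X * (X - Polynomial.C (g : ℝ))).eval (c : ℝ) *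
          ((∑ W ∈ shellIn π (S \ {v, π v}) (t' - 1) (c - g - 1), (fun x₁ x₂ : ℤ => Ψ x₁ (x₂ + 1)) ((W ∩ H₁).card : ℤ) ((W ∩ H₂).card : ℤ)) /
            ((shellIn π (S \ {v, π v}) (t' - 1) (c - g - 1)).card : ℝ)))
      + 4 * l₂ ^ 2 / (S.card : ℝ) * ∑ v ∈ S ∩ H₂, ∑ c ∈ C,
          w c * ((p * (X - Polynomial.C (g : ℝ))).eval (c : ℝ) *
          ((∑ W ∈ shellIn π (S \ {v, π v}) (t' - 1) (c - g - 1), (fun x₁ x₂ : ℤ => Ψ x₁ (x₂ + 1)) ((W ∩ H₁).card : ℤ) ((W ∩ H₂).card : ℤ)) /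
            ((shellIn π (S \ {v, π v}) (t' - 1) (c - g - 1)).card : ℝ)))
      + 4 * l₂ ^ 2 / ((S.card : ℝ) * ((S.card : ℝ) - 2)) * ∑ v ∈ S ∩ H₂, ∑ w' ∈ (S ∩ H₂) \ {v, π v}, ∑ c ∈ C,
          w c * ((p * (X - Polynomial.C (g : ℝ)) * (X - Polynomial.C ((g : ℝ) + 1))).eval (c : ℝ) *
          ((∑ W ∈ shellIn π (del2 π S v w') (t' - 2) (c - g - 2), (fun x₁ x₂ : ℤ => Ψ x₁ (x₂ + 2)) ((W ∩ H₁).card : ℤ) ((W ∩ H₂).card : ℤ)) /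
            ((shellIn π (del2 π S v w') (t' - 2) (c - g - 2)).card : ℝ)))
      + 8 * l₁ * l₂ / ((S.card : ℝ) * ((S.card : ℝ) - 2)) * ∑ v ∈ S ∩ H₁, ∑ w' ∈ S ∩ H₂, ∑ c ∈ C,
          w c * ((p * (X - Polynomial.C (g : ℝ)) * (X - Polynomial.C ((g : ℝ) + 1))).eval (c : ℝ) *
          ((∑ W ∈ shellIn π (del2 π S v w') (t' - 2) (c - g - 2),
              (fun x₁ x₂ : ℤ => Ψ (x₁ + 1) (x₂ + 1)) ((W ∩ H₁).card : ℤ) ((W ∩ H₂).card : ℤ)) /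
            ((shellIn π (del2 π S v w') (t' - 2) (c - g - 2)).card : ℝ))) := by
  -- per level
  have hlev : ∀ c ∈ C, w c * (p.eval (c : ℝ) *
        ((∑ U ∈ shellIn π S t' (c - g), Ψ ((U ∩ H₁).card : ℤ) ((U ∩ H₂).card : ℤ) *
            (2 * l₁ * (((U ∩ H₁).card : ℝ) - ((half π U ∩ H₁).card : ℝ)) +
              2 * l₂ * (((U ∩ H₂).card : ℝ) - ((half π U ∩ H₂).card : ℝ)) + L - kap * c) ^ 2) /
          ((shellIn π S t' (c - g)).card : ℝ))) =
      w c * (p.eval (c : ℝ) *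
          ((∑ U ∈ shellIn π S t' (c - g), (fun x₁ x₂ : ℤ => Ψ x₁ x₂ * (2 * l₁ * (x₁ : ℝ) + 2 * l₂ * (x₂ : ℝ) + L) ^ 2)
              ((U ∩ H₁).card : ℤ) ((U ∩ H₂).card : ℤ)) / ((shellIn π S t' (c - g)).card : ℝ)))
      - 2 * kap * (w c * ((p * X).eval (c : ℝ) *
          ((∑ U ∈ shellIn π S t' (c - g), (fun x₁ x₂ : ℤ => Ψ x₁ x₂ * (2 * l₁ * (x₁ : ℝ) + 2 * l₂ * (x₂ : ℝ) + L))
              ((U ∩ H₁).card : ℤ) ((U ∩ H₂).card : ℤ)) / ((shellIn π S t' (c - g)).card : ℝ))))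
      + kap ^ 2 * (w c * ((p * X ^ 2).eval (c : ℝ) *
          ((∑ U ∈ shellIn π S t' (c - g), Ψ ((U ∩ H₁).card : ℤ) ((U ∩ H₂).card : ℤ)) /
            ((shellIn π S t' (c - g)).card : ℝ))))
      - 4 * l₁ / (S.card : ℝ) * ∑ v ∈ S ∩ H₁, w c * ((p * (X - Polynomial.C (g : ℝ))).eval (c : ℝ) *
          ((∑ W ∈ shellIn π (S \ {v, π v}) (t' - 1) (c - g - 1),
              (fun x₁ x₂ : ℤ => Ψ (x₁ + 1) x₂ * (2 * l₁ * ((x₁ + 1 : ℤ) : ℝ) + 2 * l₂ * (x₂ : ℝ) + L))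
                ((W ∩ H₁).card : ℤ) ((W ∩ H₂).card : ℤ)) /
            ((shellIn π (S \ {v, π v}) (t' - 1) (c - g - 1)).card : ℝ)))
      + 4 * l₁ * kap / (S.card : ℝ) * ∑ v ∈ S ∩ H₁,
          w c * ((p * X * (X - Polynomial.C (g : ℝ))).eval (c : ℝ) *
          ((∑ W ∈ shellIn π (S \ {v, π v}) (t' - 1) (c - g - 1), (fun x₁ x₂ : ℤ => Ψ (x₁ + 1) x₂) ((W ∩ H₁).card : ℤ) ((W ∩ H₂).card : ℤ)) /
            ((shellIn π (S \ {v, π v}) (t' - 1) (c - g - 1)).card : ℝ)))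
      + 4 * l₁ ^ 2 / (S.card : ℝ) * ∑ v ∈ S ∩ H₁,
          w c * ((p * (X - Polynomial.C (g : ℝ))).eval (c : ℝ) *
          ((∑ W ∈ shellIn π (S \ {v, π v}) (t' - 1) (c - g - 1), (fun x₁ x₂ : ℤ => Ψ (x₁ + 1) x₂) ((W ∩ H₁).card : ℤ) ((W ∩ H₂).card : ℤ)) /
            ((shellIn π (S \ {v, π v}) (t' - 1) (c - g - 1)).card : ℝ)))
      + 4 * l₁ ^ 2 / ((S.card : ℝ) * ((S.card : ℝ) - 2)) * ∑ v ∈ S ∩ H₁, ∑ w' ∈ (S ∩ H₁) \ {v, π v},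
          w c * ((p * (X - Polynomial.C (g : ℝ)) * (X - Polynomial.C ((g : ℝ) + 1))).eval (c : ℝ) *
          ((∑ W ∈ shellIn π (del2 π S v w') (t' - 2) (c - g - 2), (fun x₁ x₂ : ℤ => Ψ (x₁ + 2) x₂) ((W ∩ H₁).card : ℤ) ((W ∩ H₂).card : ℤ)) /
            ((shellIn π (del2 π S v w') (t' - 2) (c - g - 2)).card : ℝ)))
      - 4 * l₂ / (S.card : ℝ) * ∑ v ∈ S ∩ H₂, w c * ((p * (X - Polynomial.C (g : ℝ))).eval (c : ℝ) *
          ((∑ W ∈ shellIn π (S \ {v, π v}) (t' - 1) (c - g - 1),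
              (fun x₁ x₂ : ℤ => Ψ x₁ (x₂ + 1) * (2 * l₁ * (x₁ : ℝ) + 2 * l₂ * ((x₂ + 1 : ℤ) : ℝ) + L))
                ((W ∩ H₁).card : ℤ) ((W ∩ H₂).card : ℤ)) /
            ((shellIn π (S \ {v, π v}) (t' - 1) (c - g - 1)).card : ℝ)))
      + 4 * l₂ * kap / (S.card : ℝ) * ∑ v ∈ S ∩ H₂,
          w c * ((p * X * (X - Polynomial.C (g : ℝ))).eval (c : ℝ) *
          ((∑ W ∈ shellIn π (S \ {v, π v}) (t' - 1) (c - g - 1), (fun x₁ x₂ : ℤ => Ψ x₁ (x₂ + 1)) ((W ∩ H₁).card : ℤ) ((W ∩ H₂).card : ℤ)) /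
            ((shellIn π (S \ {v, π v}) (t' - 1) (c - g - 1)).card : ℝ)))
      + 4 * l₂ ^ 2 / (S.card : ℝ) * ∑ v ∈ S ∩ H₂,
          w c * ((p * (X - Polynomial.C (g : ℝ))).eval (c : ℝ) *
          ((∑ W ∈ shellIn π (S \ {v, π v}) (t' - 1) (c - g - 1), (fun x₁ x₂ : ℤ => Ψ x₁ (x₂ + 1)) ((W ∩ H₁).card : ℤ) ((W ∩ H₂).card : ℤ)) /
            ((shellIn π (S \ {v, π v}) (t' - 1) (c - g - 1)).card : ℝ)))
      + 4 * l₂ ^ 2 / ((S.card : ℝ) * ((S.card : ℝ) - 2)) * ∑ v ∈ S ∩ H₂, ∑ w' ∈ (S ∩ H₂) \ {v, π v},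
          w c * ((p * (X - Polynomial.C (g : ℝ)) * (X - Polynomial.C ((g : ℝ) + 1))).eval (c : ℝ) *
          ((∑ W ∈ shellIn π (del2 π S v w') (t' - 2) (c - g - 2), (fun x₁ x₂ : ℤ => Ψ x₁ (x₂ + 2)) ((W ∩ H₁).card : ℤ) ((W ∩ H₂).card : ℤ)) /
            ((shellIn π (del2 π S v w') (t' - 2) (c - g - 2)).card : ℝ)))
      + 8 * l₁ * l₂ / ((S.card : ℝ) * ((S.card : ℝ) - 2)) * ∑ v ∈ S ∩ H₁, ∑ w' ∈ S ∩ H₂,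
          w c * ((p * (X - Polynomial.C (g : ℝ)) * (X - Polynomial.C ((g : ℝ) + 1))).eval (c : ℝ) *
          ((∑ W ∈ shellIn π (del2 π S v w') (t' - 2) (c - g - 2),
              (fun x₁ x₂ : ℤ => Ψ (x₁ + 1) (x₂ + 1)) ((W ∩ H₁).card : ℤ) ((W ∩ H₂).card : ℤ)) /
            ((shellIn π (del2 π S v w') (t' - 2) (c - g - 2)).card : ℝ))) := by
    intro c hc
    have hne' : 1 ≤ c - g → (shellIn π S t' (c - g)).Nonempty := fun h => hne c hc (by omega)
    rw [avg_tilted_expand₂ hπ hπ' hS hdisj hsep ht' (c - g) hne' Ψ l₁ l₂ kap L (c : ℝ)]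
    simp only [eval_mul, eval_X, eval_pow, eval_sub, eval_C, ← mul_sum]
    rcases le_or_gt g c with hgc | hgc
    · rw [Nat.cast_sub hgc]
      ring
    · rw [hpC c hc hgc]
      ring
  rw [sum_congr rfl hlev]
  exact sum_regroup12 C (S ∩ H₁) (S ∩ H₂) (fun v => (S ∩ H₁) \ {v, π v}) (fun v => (S ∩ H₂) \ {v, π v})
    _ _ _ _ _ _ _ _ _ _ _ _ _ _ _ _ _ _ _ _ _ _ _

end LevelSum

/-! ### §6 Small tools for the assembly (brick 158) -/

section Tools

/-- **Mask bounds.** For `|Ψ| ≤ G`, `Ψ ≥ 0` and an amplitude `A(x₁,x₂) = 2λ₁x₁+2λ₂x₂+L` with `|A| ≤ Λ₁` on `x₁ + x₂ ≤ b + 2`: the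
main piece `ΨA²` is bounded by `GΛ₁²` and nonnegative, `ΨA` and its two one-step shifts are bounded by `GΛ₁`, on `x₁ + x₂ ≤ b`.
[cite: Rothvoss2017, §2 (PDF p. 6)] -/
theorem mask_bounds (Ψ : ℤ → ℤ → ℝ) {G : ℝ} (hG : ∀ x₁ x₂ : ℤ, |Ψ x₁ x₂| ≤ G) (hΨ0 : ∀ x₁ x₂ : ℤ, 0 ≤ Ψ x₁ x₂)
    {l₁ l₂ L Λ₁ : ℝ} {b : ℕ}
    (hA : ∀ x₁ x₂ : ℕ, x₁ + x₂ ≤ b + 2 → |2 * l₁ * ((x₁ : ℤ) : ℝ) + 2 * l₂ * ((x₂ : ℤ) : ℝ) + L| ≤ Λ₁) :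
    (∀ x₁ x₂ : ℕ, x₁ + x₂ ≤ b →
      |(fun y₁ y₂ : ℤ => Ψ y₁ y₂ * (2 * l₁ * (y₁ : ℝ) + 2 * l₂ * (y₂ : ℝ) + L) ^ 2) x₁ x₂| ≤ G * Λ₁ ^ 2) ∧
    (∀ x₁ x₂ : ℕ, x₁ + x₂ ≤ b →
      0 ≤ (fun y₁ y₂ : ℤ => Ψ y₁ y₂ * (2 * l₁ * (y₁ : ℝ) + 2 * l₂ * (y₂ : ℝ) + L) ^ 2) x₁ x₂) ∧
    (∀ x₁ x₂ : ℕ, x₁ + x₂ ≤ b →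
      |(fun y₁ y₂ : ℤ => Ψ y₁ y₂ * (2 * l₁ * (y₁ : ℝ) + 2 * l₂ * (y₂ : ℝ) + L)) x₁ x₂| ≤ G * Λ₁) ∧
    (∀ x₁ x₂ : ℕ, x₁ + x₂ ≤ b →
      |(fun y₁ y₂ : ℤ => Ψ (y₁ + 1) y₂ * (2 * l₁ * ((y₁ + 1 : ℤ) : ℝ) + 2 * l₂ * (y₂ : ℝ) + L)) x₁ x₂| ≤ G * Λ₁) ∧
    (∀ x₁ x₂ : ℕ, x₁ + x₂ ≤ b →
      |(fun y₁ y₂ : ℤ => Ψ y₁ (y₂ + 1) * (2 * l₁ * (y₁ : ℝ) + 2 * l₂ * ((y₂ + 1 : ℤ) : ℝ) + L)) x₁ x₂| ≤ G * Λ₁) := by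
  have hG0 : 0 ≤ G := (abs_nonneg _).trans (hG 0 0)
  refine ⟨fun x₁ x₂ hx => ?_, fun x₁ x₂ _ => mul_nonneg (hΨ0 _ _) (sq_nonneg _), fun x₁ x₂ hx => ?_, fun x₁ x₂ hx => ?_,
    fun x₁ x₂ hx => ?_⟩
  · simp only [abs_mul, abs_pow]
    exact mul_le_mul (hG _ _) (pow_le_pow_left₀ (abs_nonneg _) (hA x₁ x₂ (by omega)) 2) (by positivity) hG0
  · simp only [abs_mul]
    exact mul_le_mul (hG _ _) (hA x₁ x₂ (by omega)) (abs_nonneg _) hG0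
  · have h := hA (x₁ + 1) x₂ (by omega)
    push_cast at h ⊢
    simp only [abs_mul]
    exact mul_le_mul (hG _ _) h (abs_nonneg _) hG0
  · have h := hA x₁ (x₂ + 1) (by omega)
    push_cast at h ⊢
    simp only [abs_mul]
    exact mul_le_mul (hG _ _) h (abs_nonneg _) hG0

variable {π : Fin n → Fin n} (hπ : ∀ v, π (π v) = v) (hπ' : ∀ v, π v ≠ v)
include hπ hπ'

/-- **The pinned ground sets.** Deleting one or two edges of a stable ground set `S` (with `N'` edges, no edge inside `H`, `b` edges
meeting `H`) leaves a stable ground set with `N'−1` resp. `N'−2` edges, no edge inside `H`, at most `b` edges meeting `H`.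
[cite: Rothvoss2017, §2 (PDF p. 5)] [cite: GodsilMeagher2015, §15.2] -/
theorem pinned_ground_sets {S : Finset (Fin n)} (hS : ∀ v ∈ S, π v ∈ S) {N' : ℕ} (hN : S.card = 2 * N') (H : Finset (Fin n))
    (h0 : (reps π (vAA π S H)).card = 0) {b : ℕ} (hb : (reps π (vBH π S H ∪ vBN π S H)).card = b) :
    (∀ v ∈ S, (∀ u ∈ S \ {v, π v}, π u ∈ S \ {v, π v}) ∧ (S \ {v, π v}).card = 2 * (N' - 1) ∧
      (reps π (vAA π (S \ {v, π v}) H)).card = 0 ∧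
      (reps π (vBH π (S \ {v, π v}) H ∪ vBN π (S \ {v, π v}) H)).card ≤ b) ∧
    (∀ v ∈ S, ∀ w' ∈ S, w' ≠ v → w' ≠ π v →
      (∀ u ∈ del2 π S v w', π u ∈ del2 π S v w') ∧ (del2 π S v w').card = 2 * (N' - 2) ∧
      (reps π (vAA π (del2 π S v w') H)).card = 0 ∧
      (reps π (vBH π (del2 π S v w') H ∪ vBN π (del2 π S v w') H)).card ≤ b) := by
  refine ⟨fun v hvS => ?_, fun v hvS w' hw'S h1 h2 => ?_⟩
  · have hc := card_sdiff_pair hπ' hS hvS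
    exact ⟨sdiff_pair_stable hπ hS v, by omega, reps_vAA_card_eq_zero_of_subset sdiff_subset _ h0,
      hb ▸ reps_vB_card_le_of_subset sdiff_subset _⟩
  · have hc := card_del2 hπ hπ' hS hvS hw'S h1 h2
    rw [hN] at hc
    push_cast at hc
    have hnn : (0 : ℝ) ≤ ((del2 π S v w').card : ℝ) := Nat.cast_nonneg _
    have hN2 : 2 ≤ N' := by
      have : (4 : ℝ) ≤ 2 * (N' : ℝ) := by linarith
      exact_mod_cast (show (2 : ℝ) ≤ N' by linarith)
    have hc' : (del2 π S v w').card = 2 * (N' - 2) := by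
      have e : ((del2 π S v w').card : ℝ) = ((2 * (N' - 2) : ℕ) : ℝ) := by
        rw [hc, Nat.cast_mul, Nat.cast_sub hN2]; push_cast; ring
      exact_mod_cast e
    have hsub : del2 π S v w' ⊆ S := by intro u hu; exact (mem_del2.1 hu).1
    exact ⟨del2_stable hπ hS v w', hc', reps_vAA_card_eq_zero_of_subset hsub _ h0, hb ▸ reps_vB_card_le_of_subset hsub _⟩

end Tools

end Summit.PneNP.PneNP.Theorems.ChebyshevTracialDesignTwoBlockExpansion

end
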